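import Summits.RiemannHypothesis.RiemannHypothesis.Theorems.DBNFarFieldBounds
import Summits.RiemannHypothesis.RiemannHypothesis.Theorems.DBNFarFieldLimitDefs
import HarnessLib

/-!
# RiemannHypothesis / DBN — soundness of the exact-rational T6′ certificate checker (III)

Route `RiemannHypothesis/DBN`, column DBN (D-0040 record-keeping; cell `pub-dbn`).  Proofs only:
* cast lemmas `ℚ → ℝ` for every function of `Theorems/DBNFarFieldChecker.lean` (the checker runs over
  `ℚ` under `decide`, the analysis of files I–II is over `ℝ`);
* `cover_sound` (the near-field intervals cover `[0, X)`), `exists_subinterval`, `subCheck_sound`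
  (positivity of the re-centred polynomial from the crude bound), `near_sound`, `far_sound`;
* **`checkCert_sound`**: `checkCert cert = true → FarFieldLimitAdmissible1D cert.c cert.κ`
  (evenness reduces to `ξ ≥ 0`; `ξ ≥ X` is the far field, `ξ < X` lies in a checked interval).
RH-FREE; `--supports stmt-RiemannHypothesis-0274`; nothing here bears on the truth of RH.
-/

-- D-0017: `Summit.<S>.<S>.…` is the designed namespace of a single-problem summit.
set_option linter.dupNamespace false

open MeasureTheory Set intervalIntegral
open scoped Real

namespace Summit.RiemannHypothesis.RiemannHypothesis.Theorems.DbnTheory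

namespace FarField

section Casts

/-- cast commutes with `peval`. -/
theorem peval_cast (p : List ℚ) (x : ℚ) :
    ((peval p x : ℚ) : ℝ) = peval (p.map ((↑) : ℚ → ℝ)) (x : ℝ) := by
  induction p with
  | nil => simp [peval]
  | cons a p ih => simp only [peval, List.map_cons, Rat.cast_add, Rat.cast_mul, ih]

/-- cast commutes with `padd`. -/
theorem padd_cast (p q : List ℚ) :
    (padd p q).map ((↑) : ℚ → ℝ) = padd (p.map ((↑) : ℚ → ℝ)) (q.map ((↑) : ℚ → ℝ)) := by
  induction p generalizing q with
  | nil => simp [padd]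
  | cons a p ih =>
    cases q with
    | nil => simp [padd]
    | cons b q => simp [padd, ih]

/-- cast commutes with `psmul`. -/
theorem psmul_cast (c : ℚ) (p : List ℚ) :
    (psmul c p).map ((↑) : ℚ → ℝ) = psmul (c : ℝ) (p.map ((↑) : ℚ → ℝ)) := by
  induction p with
  | nil => simp [psmul]
  | cons a p ih => simp [psmul, ih]

/-- cast commutes with `pmul`. -/
theorem pmul_cast (p q : List ℚ) :
    (pmul p q).map ((↑) : ℚ → ℝ) = pmul (p.map ((↑) : ℚ → ℝ)) (q.map ((↑) : ℚ → ℝ)) := by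
  induction p with
  | nil => simp [pmul]
  | cons a p ih => simp [pmul, padd_cast, psmul_cast, ih]

/-- cast commutes with `pshift`. -/
theorem pshift_cast (t0 : ℚ) (p : List ℚ) :
    (pshift t0 p).map ((↑) : ℚ → ℝ) = pshift (t0 : ℝ) (p.map ((↑) : ℚ → ℝ)) := by
  induction p with
  | nil => simp [pshift]
  | cons a p ih => simp [pshift, padd_cast, pmul_cast, ih]

/-- cast commutes with `pabs`. -/
theorem pabs_cast (p : List ℚ) (η : ℚ) :
    ((pabs p η : ℚ) : ℝ) = pabs (p.map ((↑) : ℚ → ℝ)) (η : ℝ) := by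
  induction p with
  | nil => simp [pabs]
  | cons a p ih => simp [pabs, ih, Rat.cast_abs]

/-- cast commutes with `pmk`. -/
theorem pmk_cast (f : ℕ → ℚ) (i m : ℕ) :
    (pmk f i m).map ((↑) : ℚ → ℝ) = pmk (fun j => (f j : ℝ)) i m := by
  induction m generalizing i with
  | zero => simp [pmk]
  | succ m ih => simp [pmk, ih]

/-- cast commutes with `cpow`. -/
theorem cpow_cast (s a : ℚ) (n : ℕ) :
    (((cpow s a n).1 : ℚ) : ℝ) = (cpow (s : ℝ) (a : ℝ) n).1 ∧
      (((cpow s a n).2 : ℚ) : ℝ) = (cpow (s : ℝ) (a : ℝ) n).2 := by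
  induction n with
  | zero => simp [cpow]
  | succ n ih =>
    simp only [cpow]
    push_cast
    rw [ih.1, ih.2]
    exact ⟨rfl, rfl⟩

/-- cast commutes with `monoInt`. -/
@[simp, norm_cast] theorem monoInt_cast (r : ℚ) (k : ℕ) :
    ((monoInt r k : ℚ) : ℝ) = monoInt (r : ℝ) k := by
  simp only [monoInt]; push_cast; ring

/-- cast commutes with `bmoment`. -/
@[simp, norm_cast] theorem bmoment_cast (α β : ℚ) (m : ℕ) :
    ((bmoment α β m : ℚ) : ℝ) = bmoment (α : ℝ) (β : ℝ) m := by
  simp only [bmoment]; push_cast; ring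

/-- cast commutes with `tcoef`. -/
@[simp, norm_cast] theorem tcoef_cast (s a : ℚ) (n : ℕ) :
    ((tcoef s a n : ℚ) : ℝ) = tcoef (s : ℝ) (a : ℝ) n := by
  simp only [tcoef]; push_cast; rw [(cpow_cast s a (n + 1)).2]

/-- cast commutes with `qpoly`. -/
theorem qpoly_cast (κ α β : ℚ) (n : ℕ) :
    (qpoly κ α β n).map ((↑) : ℚ → ℝ) = qpoly (κ : ℝ) (α : ℝ) (β : ℝ) n := by
  simp only [qpoly, pmk_cast]
  congr 1
  funext j
  push_cast
  ring

/-- cast commutes with `cellPoly`. -/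
theorem cellPoly_cast (a κ α β xc : ℚ) (N : ℕ) :
    (cellPoly a κ α β xc N).map ((↑) : ℚ → ℝ) = cellPoly (a : ℝ) (κ : ℝ) (α : ℝ) (β : ℝ) (xc : ℝ) N := by
  induction N with
  | zero => simp [cellPoly]
  | succ N ih =>
    simp only [cellPoly, padd_cast, psmul_cast, ih, qpoly_cast, tcoef_cast]
    push_cast
    rfl

/-- cast commutes with `cellRem`. -/
@[simp, norm_cast] theorem cellRem_cast (a κ α β xc h : ℚ) (N' : ℕ) :
    ((cellRem a κ α β xc h N' : ℚ) : ℝ) = cellRem (a : ℝ) (κ : ℝ) (α : ℝ) (β : ℝ) (xc : ℝ) (h : ℝ) N' := by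
  simp only [cellRem]; push_cast; ring

/-- cast commutes with `cellsOf`. -/
theorem cellsOf_cast : ∀ (pts : List ℚ),
    (cellsOf pts).map (fun p => ((p.1 : ℝ), (p.2 : ℝ))) = cellsOf (pts.map ((↑) : ℚ → ℝ))
  | [] => by simp [cellsOf]
  | [a] => by simp [cellsOf]
  | a :: b :: rest => by
      have ih := cellsOf_cast (b :: rest)
      simp only [cellsOf, List.map_cons] at ih ⊢
      rw [ih]

/-- cast commutes with `nearData`. -/
theorem nearData_cast (c κ : ℚ) (N' : ℕ) (xc h : ℚ) : ∀ (cells : List (ℚ × ℚ)),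
    (nearData c κ N' xc h cells).1.map ((↑) : ℚ → ℝ) =
        (nearData (c : ℝ) (κ : ℝ) N' (xc : ℝ) (h : ℝ) (cells.map (fun p => ((p.1 : ℝ), (p.2 : ℝ))))).1 ∧
      (((nearData c κ N' xc h cells).2 : ℚ) : ℝ) =
        (nearData (c : ℝ) (κ : ℝ) N' (xc : ℝ) (h : ℝ) (cells.map (fun p => ((p.1 : ℝ), (p.2 : ℝ))))).2
  | [] => by simp [nearData]
  | (α, β) :: rest => by
      obtain ⟨ih1, ih2⟩ := nearData_cast c κ N' xc h rest
      refine ⟨?_, ?_⟩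
      · simp only [nearData, List.map_cons, padd_cast, psmul_cast, cellPoly_cast, ih1]
        push_cast
        rfl
      · simp only [nearData, List.map_cons]
        push_cast
        rw [ih2]

/-- cast commutes with `qOf`. -/
theorem qOf_cast (xc : ℚ) (C : List ℚ) (ρ : ℚ) :
    (qOf xc C ρ).map ((↑) : ℚ → ℝ) = qOf (xc : ℝ) (C.map ((↑) : ℚ → ℝ)) (ρ : ℝ) := by
  simp [qOf, padd_cast, psmul_cast, pmul_cast]

/-- cast commutes with `ptsCheck`. -/
theorem ptsCheck_cast : ∀ (pts : List ℚ), ptsCheck (pts.map ((↑) : ℚ → ℝ)) = ptsCheck pts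
  | [] => rfl
  | [a] => by simp [ptsCheck]; norm_cast
  | a :: b :: rest => by
      have ih := ptsCheck_cast (b :: rest)
      simp only [List.map_cons] at ih
      simp only [ptsCheck, List.map_cons, ih, Rat.cast_lt]

/-- cast commutes with `farPsi`. -/
@[simp, norm_cast] theorem farPsi_cast (c κ : ℚ) : ((farPsi c κ : ℚ) : ℝ) = farPsi (c : ℝ) (κ : ℝ) := by
  simp only [farPsi]; push_cast; ring

/-- cast commutes with `farM6`. -/
@[simp, norm_cast] theorem farM6_cast (c κ : ℚ) : ((farM6 c κ : ℚ) : ℝ) = farM6 (c : ℝ) (κ : ℝ) := by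
  simp only [farM6]; push_cast; ring_nf

/-- cast commutes with `farC7`. -/
@[simp, norm_cast] theorem farC7_cast (c κ : ℚ) : ((farC7 c κ : ℚ) : ℝ) = farC7 (c : ℝ) (κ : ℝ) := by
  simp only [farC7]; push_cast; ring

/-- cast commutes with `farC10`. -/
@[simp, norm_cast] theorem farC10_cast (c κ : ℚ) : ((farC10 c κ : ℚ) : ℝ) = farC10 (c : ℝ) (κ : ℝ) := by
  simp only [farC10]; push_cast; ring

end Casts

section Sound

/-- Coverage: a point of `[lo, X)` lies in one of the listed intervals. -/
theorem cover_sound (X : ℚ) : ∀ (ivs : List (NearIv ℚ)) (lo : ℚ), coverCheck X lo ivs = true →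
    ∀ ξ : ℝ, (lo : ℝ) ≤ ξ → ξ < X → ∃ iv ∈ ivs, |ξ - (iv.xc : ℝ)| ≤ iv.h
  | [], lo, hcv, ξ, hlo, hX => by
      simp only [coverCheck, decide_eq_true_eq] at hcv
      have : (X : ℝ) ≤ lo := by exact_mod_cast hcv
      linarith
  | iv :: rest, lo, hcv, ξ, hlo, hX => by
      simp only [coverCheck, Bool.and_eq_true, decide_eq_true_eq] at hcv
      obtain ⟨h1, h2⟩ := hcv
      by_cases hξ : ξ ≤ iv.xc + iv.h
      · refine ⟨iv, List.mem_cons_self, ?_⟩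
        have : ((iv.xc - iv.h : ℚ) : ℝ) ≤ lo := by exact_mod_cast h1
        push_cast at this
        rw [abs_le]; constructor <;> linarith
      · rw [not_le] at hξ
        obtain ⟨iv', hmem, hiv'⟩ :=
          cover_sound X rest (iv.xc + iv.h) h2 ξ (by push_cast; linarith) hX
        exact ⟨iv', List.mem_cons_of_mem _ hmem, hiv'⟩

/-- Every `t ∈ [-h,h]` is within `η = h/tsub` of one of the centres `-h + (2i+1)η`, `i < tsub`. -/
theorem exists_subinterval {h : ℝ} (hh : 0 ≤ h) {tsub : ℕ} (hts : 0 < tsub) {t : ℝ} (ht : |t| ≤ h) :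
    ∃ i : ℕ, i < tsub ∧ |t - (-h + (2 * (i : ℝ) + 1) * (h / tsub))| ≤ h / tsub := by
  have hts' : (0 : ℝ) < tsub := by exact_mod_cast hts
  obtain ⟨ht1, ht2⟩ := abs_le.mp ht
  have hηt : h / tsub * tsub = h := div_mul_cancel₀ h hts'.ne'
  rcases eq_or_lt_of_le hh with h0 | hpos
  · refine ⟨0, hts, ?_⟩
    have : t = 0 := by rw [← h0] at ht1 ht2; linarith
    subst this
    rw [← h0]; simp
  · have hηpos : 0 < h / tsub := div_pos hpos hts'
    set η := h / tsub with hη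
    set x := (t + h) / (2 * η) with hx
    have hx0 : 0 ≤ x := div_nonneg (by linarith) (by linarith)
    have hx' : t + h = 2 * η * x := by rw [hx]; field_simp
    have hxle : x ≤ tsub := by
      rw [hx, div_le_iff₀ (by linarith)]; nlinarith
    by_cases hi : ⌊x⌋₊ < tsub
    · refine ⟨⌊x⌋₊, hi, ?_⟩
      have h1 : (⌊x⌋₊ : ℝ) ≤ x := Nat.floor_le hx0
      have h2 : x < ⌊x⌋₊ + 1 := Nat.lt_floor_add_one x
      rw [abs_le]; constructor <;> nlinarith
    · refine ⟨tsub - 1, Nat.sub_lt hts one_pos, ?_⟩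
      have h1 : (tsub : ℝ) ≤ ⌊x⌋₊ := by exact_mod_cast not_lt.mp hi
      have h2 : (⌊x⌋₊ : ℝ) ≤ x := Nat.floor_le hx0
      have hxe : x = tsub := le_antisymm hxle (h1.trans h2)
      have hcast : ((tsub - 1 : ℕ) : ℝ) = tsub - 1 := by
        rw [Nat.cast_sub (Nat.one_le_of_lt hts)]; simp
      rw [hcast, abs_le]; constructor <;> nlinarith

/-- Soundness of one `subCheck`: `q(t_c + τ) > 0` for `|τ| ≤ η`. -/
theorem subCheck_sound (q : List ℚ) (h : ℚ) (tsub i : ℕ) (hs : subCheck q h tsub i = true)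
    (τ : ℝ) (hτ : |τ| ≤ (h : ℝ) / tsub) :
    0 < peval (q.map ((↑) : ℚ → ℝ)) ((-(h : ℝ) + (2 * (i : ℝ) + 1) * ((h : ℝ) / tsub)) + τ) := by
  unfold subCheck at hs
  rcases hd : pshift (-h + (2 * (i : ℚ) + 1) * (h / tsub)) q with _ | ⟨d0, d⟩
  · simp [hd] at hs
  · simp only [hd, decide_eq_true_eq] at hs
    have key : peval (q.map ((↑) : ℚ → ℝ)) ((-(h : ℝ) + (2 * (i : ℝ) + 1) * ((h : ℝ) / tsub)) + τ)
        = peval ((d0 :: d).map ((↑) : ℚ → ℝ)) τ := by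
      rw [← hd, pshift_cast, peval_pshift]
      push_cast
      ring_nf
    rw [key, List.map_cons]
    have h1 := peval_cons_ge (d0 : ℝ) (d.map ((↑) : ℚ → ℝ)) hτ
    have h2 : ((h / tsub * pabs d (h / tsub) : ℚ) : ℝ) < d0 := by exact_mod_cast hs
    rw [Rat.cast_mul, pabs_cast] at h2
    push_cast at h2
    linarith

/-- **Soundness of the near-field test** of one interval. -/
theorem near_sound {c κ : ℚ} {pts : List ℚ} {iv : NearIv ℚ} (hc : 1 < c) (hκ : 0 < κ)
    (hhead : pts.head? = some (-1)) (hpts : ptsCheck pts = true)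
    (hchk : nearCheck c κ pts iv = true) {ξ : ℝ} (hξ : |ξ - (iv.xc : ℝ)| ≤ iv.h) :
    (2 / (c : ℝ)) * probeKernel c κ 0 ξ 1 ≤ 4 / (ξ ^ 2 + 4) := by
  obtain ⟨L, rfl⟩ : ∃ L, pts = (-1) :: L := by
    cases pts with
    | nil => simp at hhead
    | cons a L => simp at hhead; exact ⟨L, by rw [hhead]⟩
  simp only [nearCheck, Bool.and_eq_true, decide_eq_true_eq, List.all_eq_true] at hchk
  obtain ⟨⟨hts, hh⟩, hall⟩ := hchk
  -- the analytic bound, at ℝ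
  have hptsR : ptsCheck ((-1 : ℝ) :: L.map ((↑) : ℚ → ℝ)) = true := by
    have := ptsCheck_cast ((-1) :: L)
    simp only [List.map_cons, Rat.cast_neg, Rat.cast_one] at this
    rw [this]; exact hpts
  have hb := near_bound (c := (c : ℝ)) (κ := (κ : ℝ)) (xc := (iv.xc : ℝ)) (h := (iv.h : ℝ))
    (by exact_mod_cast hc) (by exact_mod_cast hκ.le) iv.N' hξ (L.map ((↑) : ℚ → ℝ)) hptsR
  have hcells : cellsOf ((-1 : ℝ) :: L.map ((↑) : ℚ → ℝ)) =
      (cellsOf ((-1 : ℚ) :: L)).map (fun p => ((p.1 : ℝ), (p.2 : ℝ))) := by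
    rw [cellsOf_cast]; simp
  obtain ⟨hC, hρ⟩ := nearData_cast c κ iv.N' iv.xc iv.h (cellsOf ((-1 : ℚ) :: L))
  rw [hcells, ← hC, ← hρ] at hb
  -- locate the sub-interval and use the positivity certificate
  obtain ⟨i, hi, hτ⟩ := exists_subinterval (h := (iv.h : ℝ)) (by exact_mod_cast hh) hts hξ
  have hpos := subCheck_sound _ iv.h iv.tsub i (hall i (List.mem_range.mpr hi)) _ hτ
  have ht : (-(iv.h : ℝ) + (2 * (i : ℝ) + 1) * ((iv.h : ℝ) / iv.tsub))
      + (ξ - iv.xc - (-(iv.h : ℝ) + (2 * (i : ℝ) + 1) * ((iv.h : ℝ) / iv.tsub))) = ξ - iv.xc := by ring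
  rw [ht, qOf_cast, peval_qOf] at hpos
  have hx : (iv.xc : ℝ) + (ξ - iv.xc) = ξ := by ring
  rw [hx] at hpos
  have hξ2 : 0 < ξ ^ 2 + 4 := by positivity
  rw [le_div_iff₀ hξ2]
  nlinarith

/-- **Soundness of the far-field test.** -/
theorem far_sound {c κ X : ℚ} (hc : 1 < c) (hκ : 0 < κ) (hfar : farCheck c κ X = true)
    {ξ : ℝ} (hξ : (X : ℝ) ≤ ξ) : (2 / (c : ℝ)) * probeKernel c κ 0 ξ 1 ≤ 4 / (ξ ^ 2 + 4) := by
  simp only [farCheck, Bool.and_eq_true, decide_eq_true_eq] at hfar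
  obtain ⟨⟨h2, hX⟩, hineq⟩ := hfar
  refine far_bound (X := (X : ℝ)) (by exact_mod_cast hc) (by exact_mod_cast hκ.le)
    (by exact_mod_cast h2) (by exact_mod_cast hX) ?_ hξ
  have := (Rat.cast_lt (K := ℝ)).mpr hineq
  push_cast at this
  exact this

/-- **Soundness of the certificate checker**: a checked certificate proves the far-field-limit
admissibility `FarFieldLimitAdmissible1D c κ` (T6 of Sketch2) for its pair `(c, κ)`. -/
theorem checkCert_sound (cert : Cert) (hcert : checkCert cert = true) :
    FarFieldLimitAdmissible1D (cert.c : ℝ) (cert.κ : ℝ) := by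
  simp only [checkCert, Bool.and_eq_true, decide_eq_true_eq] at hcert
  obtain ⟨⟨⟨⟨⟨⟨hc, hκ⟩, hhead⟩, hpts⟩, hcover⟩, hfar⟩, hnear⟩ := hcert
  rw [List.all_eq_true] at hnear
  unfold FarFieldLimitAdmissible1D
  intro ξ
  wlog hξ : 0 ≤ ξ generalizing ξ with H
  · have := H (-ξ) (by linarith)
    rwa [probeKernel_neg, neg_sq] at this
  by_cases hfx : (cert.X : ℝ) ≤ ξ
  · exact far_sound hc hκ hfar hfx
  · rw [not_le] at hfx
    obtain ⟨iv, hiv, hivξ⟩ := cover_sound cert.X cert.ivs 0 hcover ξ (by simpa using hξ) hfx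
    exact near_sound hc hκ hhead hpts (hnear iv hiv) hivξ

end Sound

end FarField

end Summit.RiemannHypothesis.RiemannHypothesis.Theorems.DbnTheory
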